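import Summits.QuantumFields.YangMills.Theorems.UnitScaleTiltProp7CovPinnedPeelingEL
import Summits.QuantumFields.YangMills.Theorems.UnitScaleTiltProp7CovAgmonInterp
import Summits.QuantumFields.YangMills.Theorems.UnitScaleTiltProp7TorusExpWeightSum
import HarnessLib

/-!
# Route `UnitScaleTilt`, crux K1 «MinimiserStabilityRegPr» (stmt-QuantumFields-19200), route-R E′ path (α′), (E1-b) at the CURVED background, P-cov2 row (A-door-cov), part 1:
# THE COVARIANT DOOR — the Hilbert–Schmidt `ℓ¹` mass `Σ_z √hs(Δ_U(V − U_int)(z))` of the covariant interpolation error of a datum `V` from FOUR far∕near numbers,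
# and the side conditions (pinning, biharmonicity, the `hEL` source identity) that routeR-w6 g6's covariant Agmon estimate `weighted_covLaplace_le_core` needs for the far bracket
# — the covariant twin of ✓ `Prop7PinnedKernelL1OfRows` (✓p663210) in `hs`∕re-trace letters, with the Agmon OUTPUTS `B₁`, `B₄` displayed (part 2 plugs the core in)

Cell `ym3-torus`, width seat `ym3-torus-px22` (gen 2), on ★routeR-w3 g6's word «px22 g2: (A-door-cov) LOCATE → brick» (21:47:43Z) and routeR-w6 g6's LOCATE-PCOV2 v1.2 §5 («covariant
(A-door) at `ht = s = 0` + site channel»); LOCATE 19200 evidence `LOCATE-ADOORCOV-px22g2.md` (b4fc5e92eeacdffd) §4.  `--supports stmt-QuantumFields-19200`, count-neutral.  THEOREMS ONLY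
(0 `def`, 0 `sorry`).  YM₃ on T³ is a ladder rung (R3), not the Clay problem; nothing here claims the stub, the crux, d = 4 or the gap.

THE DECOMPOSITION (✓p663210 verbatim, now for matrix fields).  `V − U_int = [(1−χ)•V − U₁] + [χ•V − u] + [u − U₂]`, `U₁ := U_int − U₂`, an IDENTITY for any `χ u U₂`; with `U_int`, `U₂` the
pinned `Δ_U`-biharmonic interpolants of `V`, `u` and `u|_C = (χ•V)|_C`, the far bracket `e₁` is pinned and `Δ_U`-biharmonic-off-`C` up to the free far field `(1−χ)•V`, so its `hEL` row
is that of `(1−χ)•V` (ANY sources `h ht s` — the peeled ones of ✓ `Prop7CovPinnedPeelingEL.el_of_peeled_cov`, or, for a COMPACTLY SUPPORTED transplant `V` (routeR-w6 §5 (a)), simply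
`h := Δ_U((1−χ)•V)`, `ht := 0`, `s := 0`); the near brackets are explicit (`N₂ N₃`) and the interpolation error of the near datum (`B₄`).

WHAT IS PROVED (ns `…Theorems.Prop7CovPinnedKernelL1OfRows`; torus `Site P i`, `T = torusT P i`, background `U`, `Δ_Uf x = divB T U (fun μ => covD T U μ f) x`, `hs` spelled out).
* §1 `covLaplace_add`, `sqrt_hs_add_le` (Frobenius triangle), `sqrt_hs_neg`, `sum_sqrt_hs_covLaplace_add_le`, `sum_sqrt_hs_covLaplace_sub_le`,
  ★ `sum_sqrt_hs_le_of_weighted` (`Σ_z √hs(F z) ≤ √Σω⁻² · √Σ_z ω(z)²hs(F z)` — the `ℓ² → ℓ¹` converter).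
* §2 side conditions of the far bracket `e₁ := (1−χ)•V − (U_int − U₂)`: `far_vanishes_on` (`e₁|_C = 0`), `far_bilaplace_off` (`Δ_U²(U_int − U₂) = 0` off `C`),
  ★★ `far_el_of_sources` (unitary `U`: an `hEL` identity for `(1−χ)•V` with sources `h ht s` IS the `hEL` identity for `e₁`, same sources — the binder of `weighted_covLaplace_le_core`),
  `el_type_one` (the type-1 instance: `h := Δ_U((1−χ)•V)`, `ht := 0`, `s := 0` always satisfies it).
* §3 ★★★ `sum_sqrt_hs_covLaplace_sub_interp_le_of_far_rows` — `Σ_z √hs(Δ_U(V − U_int) z) ≤ W·B₁ + N₂ + N₃ + W·B₄` from `√Σω⁻² ≤ W`, `√Σω²hs(Δ_Ue₁) ≤ B₁`,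
  `Σ√hs(Δ_U(χ•V)) ≤ N₂`, `Σ√hs(Δ_Uu) ≤ N₃`, `√Σω²hs(Δ_U(u − U₂)) ≤ B₄` (pure bookkeeping; `B₁ := 3H + 2(g₁+γA′)Ht + 2A′S` and `B₄ := 3·N₄` are what the core returns).
HONEST SCOPE.  Algebra + two inequalities (Cauchy–Schwarz, Frobenius triangle); no kernel estimate, no frame.  Part 2 (`…CovPinnedKernelL1OfRowsCore`) instantiates `B₁ B₄` with
routeR-w6 g6's `weighted_covLaplace_le_core` the moment its module lands; (N-cov) (the framed transplant and its seven numbers) is routeR-w6 g6's LOCATE-PCOV2 §5.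

References: T. Bałaban, CMP 99 (1985) 389–434 [Balaban1985BackgroundPropagators] ((3.8) p.392); CMP 96 (1984) 223–250 [Balaban1984PropagatorsII] ((1.9) p.226);
CMP 99 (1985) 75–102 [Balaban1985RegularSpaces] ((1.14) p.78, (1.36) p.82); CMP 102 (1985) 277–309 [Balaban1985Variational] (Prop. 7 p.299).
-/

set_option autoImplicit false

noncomputable section

open scoped BigOperators Matrix

namespace Summit.QuantumFields.YangMills.Theorems.Prop7CovPinnedKernelL1OfRows

open Literature.MathematicalPhysics.QuantumFieldTheory.Balaban1983to89
open B9Eq39Adjoint (R R_def covD covDstar divB)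
open B9TorusCalculus (torusT torusT_apply torusT_symm_apply)
open Summit.QuantumFields.YangMills.Theorems.Prop7CovariantCoercivity (re_trace_conjTranspose_mul_self)
open Summit.QuantumFields.YangMills.Theorems.Prop7CovInterpKernelDual (abs_re_trace_le_sqrt_mul_sqrt covLaplace_sub sum_re_trace_covLaplace_comm)
open Summit.QuantumFields.YangMills.Theorems.Prop7CovAgmonLetters (hs_neg)
open Summit.QuantumFields.YangMills.Theorems.Prop7CovAgmonInterp (hs_add_eq)
open Summit.QuantumFields.YangMills.Theorems.Prop7TorusExpWeightSum (sum_abs_le_sqrt_mul_sqrt)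
open Summit.QuantumFields.YangMills.Theorems.Prop7CovPinnedPeelingEL (reTr_sub_left reTr_add_left reTr_sum_left reTr_neg_left
  sum_re_trace_covLaplace_sub_biharmonic)

variable {P : Params} {i : ℕ} {N : ℕ}
variable {U : Fin P.d → Site P i → (Matrix (Fin N) (Fin N) ℂ)ˣ}

/-! ## §1 Bookkeeping: linearity, the Frobenius triangle, the `ℓ² → ℓ¹` converter -/

/-- `Δ_U(f + g) = Δ_Uf + Δ_Ug` pointwise. [cite: Balaban1985BackgroundPropagators, (3.8) p.392] -/
theorem covLaplace_add (f g : Site P i → Matrix (Fin N) (Fin N) ℂ) (x : Site P i) :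
    divB (torusT P i) U (fun μ => covD (torusT P i) U μ (fun z => f z + g z)) x
      = divB (torusT P i) U (fun μ => covD (torusT P i) U μ f) x + divB (torusT P i) U (fun μ => covD (torusT P i) U μ g) x := by
  have e : (fun z => f z + g z) = fun z => f z - (-(g z)) := funext fun z => by abel
  have e2 : (fun z => -(g z)) = fun z => (0 : Matrix (Fin N) (Fin N) ℂ) - g z := funext fun z => by abel
  rw [e, covLaplace_sub, e2, covLaplace_sub]
  simp only [divB, covDstar, covD, B9Eq39Adjoint.R_zero, sub_self, Finset.sum_const_zero, zero_sub]
  abel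

omit U in
/-- **FROBENIUS TRIANGLE**: `√hs(X + Y) ≤ √hs X + √hs Y`. [folklore] -/
theorem sqrt_hs_add_le (X Y : Matrix (Fin N) (Fin N) ℂ) :
    Real.sqrt (∑ j : Fin N, ∑ k : Fin N, ‖(X + Y) j k‖ ^ 2)
      ≤ Real.sqrt (∑ j : Fin N, ∑ k : Fin N, ‖X j k‖ ^ 2) + Real.sqrt (∑ j : Fin N, ∑ k : Fin N, ‖Y j k‖ ^ 2) := by
  have hX : 0 ≤ ∑ j : Fin N, ∑ k : Fin N, ‖X j k‖ ^ 2 := Finset.sum_nonneg fun _ _ => Finset.sum_nonneg fun _ _ => sq_nonneg _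
  have hY : 0 ≤ ∑ j : Fin N, ∑ k : Fin N, ‖Y j k‖ ^ 2 := Finset.sum_nonneg fun _ _ => Finset.sum_nonneg fun _ _ => sq_nonneg _
  have hcs := (abs_le.1 (abs_re_trace_le_sqrt_mul_sqrt X Y)).2
  rw [Real.sqrt_le_left (by positivity), hs_add_eq]
  nlinarith [Real.sq_sqrt hX, Real.sq_sqrt hY, Real.sqrt_nonneg (∑ j : Fin N, ∑ k : Fin N, ‖X j k‖ ^ 2),
    Real.sqrt_nonneg (∑ j : Fin N, ∑ k : Fin N, ‖Y j k‖ ^ 2)]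

omit U in
/-- `√hs(−X) = √hs X`. [folklore] -/
theorem sqrt_hs_neg (X : Matrix (Fin N) (Fin N) ℂ) :
    Real.sqrt (∑ j : Fin N, ∑ k : Fin N, ‖(-X) j k‖ ^ 2) = Real.sqrt (∑ j : Fin N, ∑ k : Fin N, ‖X j k‖ ^ 2) := by
  rw [hs_neg]

omit U in
/-- `√hs(X − Y) ≤ √hs X + √hs Y`. [folklore] -/
theorem sqrt_hs_sub_le (X Y : Matrix (Fin N) (Fin N) ℂ) :
    Real.sqrt (∑ j : Fin N, ∑ k : Fin N, ‖(X - Y) j k‖ ^ 2)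
      ≤ Real.sqrt (∑ j : Fin N, ∑ k : Fin N, ‖X j k‖ ^ 2) + Real.sqrt (∑ j : Fin N, ∑ k : Fin N, ‖Y j k‖ ^ 2) := by
  rw [sub_eq_add_neg, ← sqrt_hs_neg Y]
  exact sqrt_hs_add_le X (-Y)

/-- `Σ_z √hs(Δ_U(F₁ + F₂)) ≤ Σ_z √hs(Δ_UF₁) + Σ_z √hs(Δ_UF₂)`. [cite: Balaban1985BackgroundPropagators, (3.8) p.392] -/
theorem sum_sqrt_hs_covLaplace_add_le (F₁ F₂ : Site P i → Matrix (Fin N) (Fin N) ℂ) :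
    ∑ z, Real.sqrt (∑ j : Fin N, ∑ k : Fin N, ‖(divB (torusT P i) U (fun μ => covD (torusT P i) U μ (fun y => F₁ y + F₂ y)) z) j k‖ ^ 2)
      ≤ ∑ z, Real.sqrt (∑ j : Fin N, ∑ k : Fin N, ‖(divB (torusT P i) U (fun μ => covD (torusT P i) U μ F₁) z) j k‖ ^ 2)
        + ∑ z, Real.sqrt (∑ j : Fin N, ∑ k : Fin N, ‖(divB (torusT P i) U (fun μ => covD (torusT P i) U μ F₂) z) j k‖ ^ 2) := by
  rw [← Finset.sum_add_distrib]
  exact Finset.sum_le_sum fun z _ => by rw [covLaplace_add]; exact sqrt_hs_add_le _ _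

/-- `Σ_z √hs(Δ_U(F₁ − F₂)) ≤ Σ_z √hs(Δ_UF₁) + Σ_z √hs(Δ_UF₂)`. [cite: Balaban1985BackgroundPropagators, (3.8) p.392] -/
theorem sum_sqrt_hs_covLaplace_sub_le (F₁ F₂ : Site P i → Matrix (Fin N) (Fin N) ℂ) :
    ∑ z, Real.sqrt (∑ j : Fin N, ∑ k : Fin N, ‖(divB (torusT P i) U (fun μ => covD (torusT P i) U μ (fun y => F₁ y - F₂ y)) z) j k‖ ^ 2)
      ≤ ∑ z, Real.sqrt (∑ j : Fin N, ∑ k : Fin N, ‖(divB (torusT P i) U (fun μ => covD (torusT P i) U μ F₁) z) j k‖ ^ 2)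
        + ∑ z, Real.sqrt (∑ j : Fin N, ∑ k : Fin N, ‖(divB (torusT P i) U (fun μ => covD (torusT P i) U μ F₂) z) j k‖ ^ 2) := by
  rw [← Finset.sum_add_distrib]
  exact Finset.sum_le_sum fun z _ => by rw [covLaplace_sub]; exact sqrt_hs_sub_le _ _

omit U in
/-- ★ **THE `ℓ² → ℓ¹` CONVERTER IN `hs` LETTERS**: `Σ_z √hs(F z) ≤ √Σω⁻² · √Σ_z ω(z)²·hs(F z)` for a positive weight `ω` (Cauchy–Schwarz on `ω⁻¹·(ω√hs)`).
[cite: Balaban1984PropagatorsII, (1.9) p.226] -/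
theorem sum_sqrt_hs_le_of_weighted (ω : Site P i → ℝ) (hω₀ : ∀ x, 0 < ω x) (F : Site P i → Matrix (Fin N) (Fin N) ℂ) {W : ℝ}
    (hW : Real.sqrt (∑ z, (ω z)⁻¹ ^ 2) ≤ W) :
    ∑ z, Real.sqrt (∑ j : Fin N, ∑ k : Fin N, ‖(F z) j k‖ ^ 2)
      ≤ W * Real.sqrt (∑ z, ω z ^ 2 * ∑ j : Fin N, ∑ k : Fin N, ‖(F z) j k‖ ^ 2) := by
  have h := sum_abs_le_sqrt_mul_sqrt Finset.univ ω (fun z => Real.sqrt (∑ j : Fin N, ∑ k : Fin N, ‖(F z) j k‖ ^ 2)) fun x _ => hω₀ x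
  have e1 : ∑ z, |Real.sqrt (∑ j : Fin N, ∑ k : Fin N, ‖(F z) j k‖ ^ 2)| = ∑ z, Real.sqrt (∑ j : Fin N, ∑ k : Fin N, ‖(F z) j k‖ ^ 2) :=
    Finset.sum_congr rfl fun z _ => abs_of_nonneg (Real.sqrt_nonneg _)
  have e2 : ∑ z, (ω z * Real.sqrt (∑ j : Fin N, ∑ k : Fin N, ‖(F z) j k‖ ^ 2)) ^ 2 = ∑ z, ω z ^ 2 * ∑ j : Fin N, ∑ k : Fin N, ‖(F z) j k‖ ^ 2 :=
    Finset.sum_congr rfl fun z _ => by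
      rw [mul_pow, Real.sq_sqrt (Finset.sum_nonneg fun _ _ => Finset.sum_nonneg fun _ _ => sq_nonneg _)]
  rw [e1, e2] at h
  exact h.trans (mul_le_mul_of_nonneg_right hW (Real.sqrt_nonneg _))

/-! ## §2 The far bracket `e₁ := (1−χ)•V − (U_int − U₂)`: pinning, biharmonicity, the `hEL` row -/

/-- **`e₁` IS PINNED**: `U_int|_C = V|_C`, `U₂|_C = u|_C = (χ•V)|_C` ⇒ `((1−χ)•V − (U_int − U₂))|_C = 0`. [cite: Balaban1985RegularSpaces, (1.14) p.78] -/
theorem far_vanishes_on (C : Set (Site P i)) (χ : Site P i → ℝ) (V Ui u U₂ : Site P i → Matrix (Fin N) (Fin N) ℂ)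
    (hUC : ∀ x ∈ C, Ui x = V x) (hu : ∀ x ∈ C, u x = χ x • V x) (hU₂C : ∀ x ∈ C, U₂ x = u x) :
    ∀ y ∈ C, (fun x => (1 - χ x) • V x - (Ui x - U₂ x)) y = 0 := by
  intro y hy
  simp only [hUC y hy, hU₂C y hy, hu y hy, sub_smul, one_smul]
  abel

/-- **`U_int − U₂` IS `Δ_U`-BIHARMONIC OFF `C`** (both pieces are). [cite: Balaban1985RegularSpaces, (1.14) p.78] -/
theorem far_bilaplace_off (C : Set (Site P i)) (Ui U₂ : Site P i → Matrix (Fin N) (Fin N) ℂ)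
    (hUel : ∀ x ∉ C, divB (torusT P i) U (fun μ => covD (torusT P i) U μ
      (fun y => divB (torusT P i) U (fun ν => covD (torusT P i) U ν Ui) y)) x = 0)
    (hU₂el : ∀ x ∉ C, divB (torusT P i) U (fun μ => covD (torusT P i) U μ
      (fun y => divB (torusT P i) U (fun ν => covD (torusT P i) U ν U₂) y)) x = 0) :
    ∀ x ∉ C, divB (torusT P i) U (fun μ => covD (torusT P i) U μ
      (fun y => divB (torusT P i) U (fun ν => covD (torusT P i) U ν (fun z => Ui z - U₂ z)) y)) x = 0 := by
  intro x hx
  have e : (fun y => divB (torusT P i) U (fun ν => covD (torusT P i) U ν (fun z => Ui z - U₂ z)) y)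
      = fun y => divB (torusT P i) U (fun ν => covD (torusT P i) U ν Ui) y - divB (torusT P i) U (fun ν => covD (torusT P i) U ν U₂) y :=
    funext fun y => covLaplace_sub Ui U₂ y
  rw [e, covLaplace_sub, hUel x hx, hU₂el x hx, sub_zero]

/-- ★★ **THE `hEL` ROW OF THE FAR BRACKET IS THAT OF THE FREE FAR FIELD** (unitary `U`): if `Σ⟨Δ_U((1−χ)•V), Δ_Uv⟩ = Σ⟨h, Δ_Uv⟩ + ΣΣ⟨ht_μ, D_μv⟩ + Σ⟨s, v⟩` for all pinned `v`,
then the same identity holds with `(1−χ)•V` replaced by `e₁ := (1−χ)•V − (U_int − U₂)` (`U_int − U₂` biharmonic off `C` drops out, ✓ `sum_re_trace_covLaplace_sub_biharmonic`) — this is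
VERBATIM the `hEL` binder of routeR-w6 g6's `weighted_covLaplace_le_core` for `e := e₁`. [cite: Balaban1984PropagatorsII, (1.9) p.226; Balaban1985BackgroundPropagators, (3.8) p.392] -/
theorem far_el_of_sources (hU : ∀ ν x, (U ν x : Matrix (Fin N) (Fin N) ℂ) ∈ unitary (Matrix (Fin N) (Fin N) ℂ))
    (C : Set (Site P i)) (χ : Site P i → ℝ) (V Ui U₂ h s : Site P i → Matrix (Fin N) (Fin N) ℂ) (ht : Fin P.d → Site P i → Matrix (Fin N) (Fin N) ℂ)
    (hUel : ∀ x ∉ C, divB (torusT P i) U (fun μ => covD (torusT P i) U μ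
      (fun y => divB (torusT P i) U (fun ν => covD (torusT P i) U ν Ui) y)) x = 0)
    (hU₂el : ∀ x ∉ C, divB (torusT P i) U (fun μ => covD (torusT P i) U μ
      (fun y => divB (torusT P i) U (fun ν => covD (torusT P i) U ν U₂) y)) x = 0)
    (hELF : ∀ v : Site P i → Matrix (Fin N) (Fin N) ℂ, (∀ y ∈ C, v y = 0) →
      ∑ x, (((divB (torusT P i) U (fun μ => covD (torusT P i) U μ (fun y => (1 - χ y) • V y)) x)ᴴ
          * divB (torusT P i) U (fun μ => covD (torusT P i) U μ v) x).trace).re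
        = ∑ x, (((h x)ᴴ * divB (torusT P i) U (fun μ => covD (torusT P i) U μ v) x).trace).re
          + ∑ x, ∑ μ, (((ht μ x)ᴴ * covD (torusT P i) U μ v x).trace).re
          + ∑ x, (((s x)ᴴ * v x).trace).re) :
    ∀ v : Site P i → Matrix (Fin N) (Fin N) ℂ, (∀ y ∈ C, v y = 0) →
      ∑ x, (((divB (torusT P i) U (fun μ => covD (torusT P i) U μ (fun y => (1 - χ y) • V y - (Ui y - U₂ y))) x)ᴴ
          * divB (torusT P i) U (fun μ => covD (torusT P i) U μ v) x).trace).re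
        = ∑ x, (((h x)ᴴ * divB (torusT P i) U (fun μ => covD (torusT P i) U μ v) x).trace).re
          + ∑ x, ∑ μ, (((ht μ x)ᴴ * covD (torusT P i) U μ v x).trace).re
          + ∑ x, (((s x)ᴴ * v x).trace).re := by
  intro v hv
  rw [sum_re_trace_covLaplace_sub_biharmonic hU C (fun y => (1 - χ y) • V y) (fun y => Ui y - U₂ y)
    (far_bilaplace_off C Ui U₂ hUel hU₂el) v hv]
  exact hELF v hv

/-- **THE TYPE-1 INSTANCE** (routeR-w6 g6 LOCATE-PCOV2 §5 (a): a compactly supported transplant needs no peeling): with `h := Δ_U((1−χ)•V)`, `ht := 0`, `s := 0` the free far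
field's `hEL` identity holds trivially. [cite: Balaban1984PropagatorsII, (1.9) p.226] -/
theorem el_type_one (C : Set (Site P i)) (χ : Site P i → ℝ) (V : Site P i → Matrix (Fin N) (Fin N) ℂ) :
    ∀ v : Site P i → Matrix (Fin N) (Fin N) ℂ, (∀ y ∈ C, v y = 0) →
      ∑ x, (((divB (torusT P i) U (fun μ => covD (torusT P i) U μ (fun y => (1 - χ y) • V y)) x)ᴴ
          * divB (torusT P i) U (fun μ => covD (torusT P i) U μ v) x).trace).re
        = ∑ x, (((divB (torusT P i) U (fun μ => covD (torusT P i) U μ (fun y => (1 - χ y) • V y)) x)ᴴ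
            * divB (torusT P i) U (fun μ => covD (torusT P i) U μ v) x).trace).re
          + ∑ x, ∑ μ, (((0 : Matrix (Fin N) (Fin N) ℂ)ᴴ * covD (torusT P i) U μ v x).trace).re
          + ∑ x, (((0 : Matrix (Fin N) (Fin N) ℂ)ᴴ * v x).trace).re := by
  intro v _
  simp

/-! ## §3 ★★★ The covariant door (far∕near bookkeeping) -/

/-- ★★★ **THE COVARIANT DOOR.**  Torus `Site P i`, background `U`, centres `C`; a real cutoff `χ`, a matrix datum `V` with pinned interpolant `U_int`, a near datum `u` with pinned
interpolant `U₂` (no hypothesis on them is needed for this bookkeeping — the split `V − U_int = [(1−χ)•V − (U_int − U₂)] + [χ•V − u] + [u − U₂]` is an identity); a positive weight `ω`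
with `√Σω⁻² ≤ W`; and FOUR numbers: the Agmon outputs `√Σω²hs(Δ_Ue₁) ≤ B₁` (far bracket) and `√Σω²hs(Δ_U(u − U₂)) ≤ B₄` (near interpolation error), and the explicit near masses
`Σ√hs(Δ_U(χ•V)) ≤ N₂`, `Σ√hs(Δ_Uu) ≤ N₃`.  THEN `Σ_z √hs(Δ_U(V − U_int) z) ≤ W·B₁ + N₂ + N₃ + W·B₄`.  With routeR-w6 g6's `weighted_covLaplace_le_core` (pinning ⟸ `far_vanishes_on`,
`hEL` ⟸ `far_el_of_sources`): `B₁ = 3H + 2(g₁+γA′)Ht + 2A′S`, `B₄ = 3N₄` — the covariant (hK) row `Σ_z‖Δ_Uw_{b,X}‖_HS ≤ κ‖X‖_HS` of ✓ `Prop7CovInterpKernelDual` once the seven numbers are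
read at scale `ℓ = L^k` from the framed transplant (LOCATE-PCOV2 §5). [cite: Balaban1984PropagatorsII, (1.9) p.226; Balaban1985RegularSpaces, (1.36) p.82; Balaban1985Variational, Prop. 7 p.299] -/
theorem sum_sqrt_hs_covLaplace_sub_interp_le_of_far_rows (χ : Site P i → ℝ) (V Ui u U₂ : Site P i → Matrix (Fin N) (Fin N) ℂ)
    (ω : Site P i → ℝ) (hω₀ : ∀ x, 0 < ω x) {W B₁ B₄ N₂ N₃ : ℝ}
    (hW : Real.sqrt (∑ z, (ω z)⁻¹ ^ 2) ≤ W)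
    (hB₁ : Real.sqrt (∑ z, ω z ^ 2 * ∑ j : Fin N, ∑ k : Fin N,
      ‖(divB (torusT P i) U (fun μ => covD (torusT P i) U μ (fun y => (1 - χ y) • V y - (Ui y - U₂ y))) z) j k‖ ^ 2) ≤ B₁)
    (hN₂ : ∑ z, Real.sqrt (∑ j : Fin N, ∑ k : Fin N, ‖(divB (torusT P i) U (fun μ => covD (torusT P i) U μ (fun y => χ y • V y)) z) j k‖ ^ 2) ≤ N₂)
    (hN₃ : ∑ z, Real.sqrt (∑ j : Fin N, ∑ k : Fin N, ‖(divB (torusT P i) U (fun μ => covD (torusT P i) U μ u) z) j k‖ ^ 2) ≤ N₃)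
    (hB₄ : Real.sqrt (∑ z, ω z ^ 2 * ∑ j : Fin N, ∑ k : Fin N,
      ‖(divB (torusT P i) U (fun μ => covD (torusT P i) U μ (fun y => u y - U₂ y)) z) j k‖ ^ 2) ≤ B₄) :
    ∑ z, Real.sqrt (∑ j : Fin N, ∑ k : Fin N, ‖(divB (torusT P i) U (fun μ => covD (torusT P i) U μ (fun y => V y - Ui y)) z) j k‖ ^ 2)
      ≤ W * B₁ + N₂ + N₃ + W * B₄ := by
  have hW0 : 0 ≤ W := (Real.sqrt_nonneg _).trans hW
  -- the three brackets
  set e : Site P i → Matrix (Fin N) (Fin N) ℂ := fun x => (1 - χ x) • V x - (Ui x - U₂ x) with he_def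
  set m : Site P i → Matrix (Fin N) (Fin N) ℂ := fun x => χ x • V x - u x with hm_def
  set r : Site P i → Matrix (Fin N) (Fin N) ℂ := fun x => u x - U₂ x with hr_def
  have hsplit : (fun y => V y - Ui y) = fun y => e y + (m y + r y) := by
    funext y; simp only [he_def, hm_def, hr_def, sub_smul, one_smul]; abel
  -- (T1) far bracket
  have hT1 : ∑ z, Real.sqrt (∑ j : Fin N, ∑ k : Fin N, ‖(divB (torusT P i) U (fun μ => covD (torusT P i) U μ e) z) j k‖ ^ 2) ≤ W * B₁ :=
    (sum_sqrt_hs_le_of_weighted ω hω₀ _ hW).trans (mul_le_mul_of_nonneg_left hB₁ hW0)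
  -- (T2)+(T3) explicit near bracket
  have hT23 : ∑ z, Real.sqrt (∑ j : Fin N, ∑ k : Fin N, ‖(divB (torusT P i) U (fun μ => covD (torusT P i) U μ m) z) j k‖ ^ 2) ≤ N₂ + N₃ :=
    (sum_sqrt_hs_covLaplace_sub_le (fun y => χ y • V y) u).trans (add_le_add hN₂ hN₃)
  -- (T4) near interpolation error
  have hT4 : ∑ z, Real.sqrt (∑ j : Fin N, ∑ k : Fin N, ‖(divB (torusT P i) U (fun μ => covD (torusT P i) U μ r) z) j k‖ ^ 2) ≤ W * B₄ :=
    (sum_sqrt_hs_le_of_weighted ω hω₀ _ hW).trans (mul_le_mul_of_nonneg_left hB₄ hW0)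
  rw [hsplit]
  calc ∑ z, Real.sqrt (∑ j : Fin N, ∑ k : Fin N, ‖(divB (torusT P i) U (fun μ => covD (torusT P i) U μ (fun y => e y + (m y + r y))) z) j k‖ ^ 2)
      ≤ ∑ z, Real.sqrt (∑ j : Fin N, ∑ k : Fin N, ‖(divB (torusT P i) U (fun μ => covD (torusT P i) U μ e) z) j k‖ ^ 2)
        + ∑ z, Real.sqrt (∑ j : Fin N, ∑ k : Fin N, ‖(divB (torusT P i) U (fun μ => covD (torusT P i) U μ (fun y => m y + r y)) z) j k‖ ^ 2) :=
        sum_sqrt_hs_covLaplace_add_le e _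
    _ ≤ ∑ z, Real.sqrt (∑ j : Fin N, ∑ k : Fin N, ‖(divB (torusT P i) U (fun μ => covD (torusT P i) U μ e) z) j k‖ ^ 2)
        + (∑ z, Real.sqrt (∑ j : Fin N, ∑ k : Fin N, ‖(divB (torusT P i) U (fun μ => covD (torusT P i) U μ m) z) j k‖ ^ 2)
          + ∑ z, Real.sqrt (∑ j : Fin N, ∑ k : Fin N, ‖(divB (torusT P i) U (fun μ => covD (torusT P i) U μ r) z) j k‖ ^ 2)) :=
        add_le_add le_rfl (sum_sqrt_hs_covLaplace_add_le m r)
    _ ≤ W * B₁ + ((N₂ + N₃) + W * B₄) := add_le_add hT1 (add_le_add hT23 hT4)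
    _ = W * B₁ + N₂ + N₃ + W * B₄ := by ring

end Summit.QuantumFields.YangMills.Theorems.Prop7CovPinnedKernelL1OfRows

end
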